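import Summits.AnomalousDissipation.AnomalousDissipation.Theorems.WazewskiBlockPlanarGalerkinNoTrapCoeffODE
import Literature.Analysis.FluidPDE.NSHopfLimit
import HarnessLib

/-!
# Crux `PumpedMirror.MirrorBoundedFromRestTG` (stmt-AnomalousDissipation-15373), line `birth`:
# the exact-force Galerkin approximations from rest are UNIQUE, order by order

The open stub of the reshaped birth skeleton (`stub_galerkinLateCeilingTrajFromRest`) quantifies
over Galerkin trajectories of the Taylor–Green force from rest; the closed stubs A/C quantify over
exact-force Hopf–Galerkin schemes from rest. This support file certifies that these quantifiers
range, at each viscosity and each Galerkin order, over ONE object — "what a (symmetric) Taylor–Green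
DNS computes":

* `slice_zero_eq_zero` — every member of an exact-force Hopf–Galerkin scheme from rest starts at
  the zero field: `U n 0 = 0` (pointwise; `∫ ‖U n 0‖² ≤ ∫ ‖0‖² = 0` and continuity);
* `galerkinTrajectory_unique` — two field-level Galerkin trajectories (steady force `f ∈ L²`,
  order `N`) with the same initial slice coincide for all `t ≥ 0` (the tree's bridge
  `WazewskiBlock.PlanarGalerkinNoTrap.isGalerkinTrajectory_coeff` to the coefficient ODE, whose
  solutions are unique, `IsGalerkinODESolution.eqOn`; Robinson–Rodrigo–Sadowski 2016, Thm. 4.4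
  Step 1: "existence and uniqueness … from the classical theory of ODEs");
* `exactScheme_slice_eq` — hence two exact-force schemes from rest for the same `(ν, f)` agree at
  every pair of indices of equal order: `N n = N' n' → U n t = U' n' t` for `t ≥ 0`;
* `galerkinTrajectoryFromRest_unique` — the registered auxiliary statement (`Fin 3`): for each
  `ν`, `f` continuous and order `m` there is at most one Galerkin trajectory of order `m` from rest.

References: J. C. Robinson, J. L. Rodrigo, W. Sadowski, *The three-dimensional Navier–Stokes
equations* (CUP 2016), §4.1, Thm. 4.4 Step 1; P. Constantin, C. Foias, *Navier–Stokes Equations*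
(Chicago 1988), Ch. 8, (8.5)–(8.6).
-/

-- the mandated namespace repeats `AnomalousDissipation` (single-conjunct summit)
set_option linter.dupNamespace false

noncomputable section

open MeasureTheory Set Filter
open scoped ENNReal NNReal InnerProductSpace RealInnerProductSpace

namespace Summit.AnomalousDissipation.AnomalousDissipation.Theorems.PumpedMirror.MirrorBoundedFromRestTG.FromRest

open Literature.Analysis.FluidPDE Literature.Analysis.FunctionSpaces Literature.Analysis.FunctionSpaces.Torus
open Summit.AnomalousDissipation.AnomalousDissipation.Theorems.WazewskiBlock.PlanarGalerkinNoTrap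

variable {d : Type*} [Fintype d] [DecidableEq d]

/-- **From rest every Galerkin approximation starts at zero.** For a Hopf–Galerkin scheme with
datum `0` (any forces), `U n 0 = 0` pointwise: `∫ ‖U n 0‖² ≤ ∫ ‖0‖² = 0`
(`IsHopfGalerkinScheme.integral_norm_sq_zero_le`) and the slice is continuous. [folklore] -/
theorem slice_zero_eq_zero {ν : ℝ} {f : ℝ → UnitAddTorus d → EuclideanSpace ℝ d} {N : ℕ → ℕ}
    {F U : ℕ → ℝ → UnitAddTorus d → EuclideanSpace ℝ d} (hS : IsHopfGalerkinScheme ν f 0 N F U)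
    (n : ℕ) : U n 0 = 0 := by
  have hle : ∫ x, ‖U n 0 x‖ ^ 2 ≤ 0 := by
    have h := hS.integral_norm_sq_zero_le (MemLp.zero' (ε := EuclideanSpace ℝ d)) n
    simpa using h
  have hc : Continuous (U n 0) := hS.continuous_slice n le_rfl
  have hint : Integrable (fun x => ‖U n 0 x‖ ^ 2) volume := (hc.norm.pow 2).integrable_unitAddTorus
  have h0 : ∫ x, ‖U n 0 x‖ ^ 2 = 0 :=
    le_antisymm hle (integral_nonneg fun x => sq_nonneg _)
  have hae : (fun x => ‖U n 0 x‖ ^ 2) =ᵐ[volume] 0 :=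
    (integral_eq_zero_iff_of_nonneg (fun x => sq_nonneg _) hint).1 h0
  have heq : (fun x => ‖U n 0 x‖ ^ 2) = 0 :=
    (hc.norm.pow 2).ae_eq_iff_eq volume continuous_const |>.1 hae
  funext x
  have hx := congrFun heq x
  simp only [Pi.zero_apply, ne_eq, OfNat.ofNat_ne_zero, not_false_eq_true, pow_eq_zero_iff,
    norm_eq_zero] at hx
  rw [hx, Pi.zero_apply]

/-- **Uniqueness of field-level Galerkin trajectories** (Robinson–Rodrigo–Sadowski 2016, Thm. 4.4
Step 1; Constantin–Foias 1988, p. 43): two Galerkin trajectories of order `N` driven by the same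
steady force `f ∈ L²` with the same initial slice agree for all `t ≥ 0`. Proof: their restricted
Fourier coefficients solve the same Galerkin ODE from the same datum (`isGalerkinTrajectory_coeff`),
hence agree (`IsGalerkinODESolution.eqOn`), and each slice is the trigonometric polynomial of its
coefficients (`eq_realTrigPoly_coeff`). [cite: RobinsonRodrigoSadowski2016, Thm. 4.4 Step 1] -/
theorem galerkinTrajectory_unique {ν : ℝ} {f : UnitAddTorus d → EuclideanSpace ℝ d} {N : ℕ}
    {U V : ℝ → UnitAddTorus d → EuclideanSpace ℝ d} (hU : Torus.IsGalerkinTrajectory ν f N U)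
    (hV : Torus.IsGalerkinTrajectory ν f N V) (hf : MemLp f 2 volume) (h0 : U 0 = V 0) {t : ℝ}
    (ht : 0 ≤ t) : U t = V t := by
  have hα := (isGalerkinTrajectory_coeff hU hf).isGalerkinODESolution
  have hβ := (isGalerkinTrajectory_coeff hV hf).isGalerkinODESolution
  rw [h0] at hα
  have heq := hα.eqOn hβ (Set.mem_Ici.2 ht)
  simp only at heq
  rw [eq_realTrigPoly_coeff hU ht, eq_realTrigPoly_coeff hV ht, heq]

/-- **Exact-force Galerkin schemes from rest agree index by index at equal orders**: for two
Hopf–Galerkin schemes for `(ν, f, 0)` both driven at every order by the steady force `f` itself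
(`f` continuous), `N n = N' n'` implies `U n t = U' n' t` for all `t ≥ 0` — each member is THE
Galerkin trajectory of its order from rest (`slice_zero_eq_zero`, `galerkinTrajectory_unique`). [folklore] -/
theorem exactScheme_slice_eq {ν : ℝ} {f : UnitAddTorus d → EuclideanSpace ℝ d} (hf : Continuous f)
    {N N' : ℕ → ℕ} {U U' : ℕ → ℝ → UnitAddTorus d → EuclideanSpace ℝ d}
    (hS : IsHopfGalerkinScheme ν (fun _ => f) 0 N (fun _ _ => f) U)
    (hS' : IsHopfGalerkinScheme ν (fun _ => f) 0 N' (fun _ _ => f) U') {n n' : ℕ}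
    (hNN : N n = N' n') {t : ℝ} (ht : 0 ≤ t) : U n t = U' n' t := by
  have hfL : MemLp f 2 volume := hf.memLp_of_hasCompactSupport (HasCompactSupport.of_compactSpace f)
  have hT := hS.isGalerkinTrajectory n
  have hT' := hS'.isGalerkinTrajectory n'
  rw [hNN] at hT
  exact galerkinTrajectory_unique hT hT' hfL
    ((slice_zero_eq_zero hS n).trans (slice_zero_eq_zero hS' n').symm) ht

/-- **At most one Galerkin trajectory of each order from rest** (the registered auxiliary statement
of the crux line, `𝕋³`): for a continuous steady force `f`, viscosity `ν` and order `m`, two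
Galerkin trajectories of order `m` with `U 0 = 0 = V 0` coincide for all `t ≥ 0` — so the open stub
`stub_galerkinLateCeilingTrajFromRest` and the closed stubs of the birth skeleton speak, at each
`(ν, m)`, about ONE object (the symmetric Taylor–Green Galerkin flow from rest of that order). [folklore] -/
theorem galerkinTrajectoryFromRest_unique :
    ∀ (ν : ℝ) (f : UnitAddTorus (Fin 3) → EuclideanSpace ℝ (Fin 3)), Continuous f →
      ∀ (m : ℕ) (U V : ℝ → UnitAddTorus (Fin 3) → EuclideanSpace ℝ (Fin 3)),
        Literature.Analysis.FluidPDE.Torus.IsGalerkinTrajectory ν f m U →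
        Literature.Analysis.FluidPDE.Torus.IsGalerkinTrajectory ν f m V →
        U 0 = 0 → V 0 = 0 → ∀ t : ℝ, 0 ≤ t → U t = V t := by
  intro ν f hf m U V hU hV hU0 hV0 t ht
  exact galerkinTrajectory_unique hU hV
    (hf.memLp_of_hasCompactSupport (HasCompactSupport.of_compactSpace f)) (hU0.trans hV0.symm) ht

end Summit.AnomalousDissipation.AnomalousDissipation.Theorems.PumpedMirror.MirrorBoundedFromRestTG.FromRest

end
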